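import Literature.MathematicalPhysics.QuantumLattice.HubbardTTPrimeBoxHamiltonian
import Literature.MathematicalPhysics.QuantumLattice.InfVolFermionStateTTPrimeMeanEnergyBox
import Literature.MathematicalPhysics.QuantumLattice.HubbardNNNHoppingEnergyDensityConvex
import Literature.MathematicalPhysics.QuantumLattice.HubbardTTPrimeTorusLimitState
import Literature.MathematicalPhysics.QuantumLattice.HubbardEnergyDensityVariationalPrinciple
import HarnessLib

/-!
# The variational principle for the ground-state energy density of the `t–t'` Hubbard model on `ℤ²`:
# `energyDensityTT'` is the least mean energy of a translation-invariant state

Topic `Literature/MathematicalPhysics/QuantumLattice`; namespace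
`Literature.MathematicalPhysics.QuantumLattice` (the file path). The `t–t'` twin of
`HubbardEnergyDensityVariationalPrinciple.lean`. Ruelle's thermodynamic limit
`e(n) = energyDensityTT' t t' U n` of the canonical ground-state energy per site of the square-lattice
Hubbard model with nearest-neighbour hopping `t`, next-nearest-neighbour (diagonal) hopping `t'` and
on-site repulsion `U ≥ 0` (`HubbardNNNHoppingThermodynamicLimit.lean`) is a LOWER BOUND for the mean
energy `e^{tt'}(ω) = ω.meanEnergy (hubbardTTPrimeFermionInteraction t t' U) 1` of EVERY
translation-invariant infinite-volume state `ω` of the lattice fermion system on `ℤ²` with particle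
density `n ∈ (0,2)`:

`InfVolFermionState.IsTranslationInvariant.energyDensityTT'_le_meanEnergy :
  energyDensityTT' t t' U ω.density ≤ ω.meanEnergy (hubbardTTPrimeFermionInteraction t t' U) 1`,

and the bound is ATTAINED by the torus limits of sector ground states
(`exists_isTorusLimitOf_squareGroundStatesTT'_meanEnergy_eq`), so `energyDensityTT' t t' U ρ` is the
least `t–t'` mean energy of a translation-invariant state of density `ρ`
(`isLeast_meanEnergy_energyDensityTT'`) — the Bratteli–Kishimoto–Robinson / Araki–Moriya
characterisation of translation-invariant ground states as minimisers of the mean energy, at fixed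
density, for the `t–t'` Hubbard model, with Ruelle's elementary proof (*Statistical Mechanics* (1969)
§2.4, §3.3–3.4): restrict `ω` to the boxes `[0,ℓ)²`; the box Hamiltonian expectation is within
`(8|t| + 16|t'|)ℓ` of `ℓ² e^{tt'}(ω)` (`InfVolFermionStateTTPrimeMeanEnergyBox`); it is at least the
number-distribution average of the sector ground energies of the box Hamiltonian, which is the
open-cluster Hamiltonian `hubbardOpenBoxTT' ℓ ℓ` (`HubbardTTPrimeBoxHamiltonian`); every sector ground
energy `E(N)`, `N < 2ℓ²`, is at least `ℓ² e(N/ℓ²)` EXACTLY (`energyDensityTT'_le_openBox`), hence above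
the affine minorant `ℓ²(e(ρ) + s(N/ℓ² - ρ))` of the convex `e` (`exists_supporting_line_energyDensityTT'`),
and the filled band `E(2ℓ²) = Uℓ²` lies above it too (`supporting_line_energyDensityTT'_at_two_le`);
the affine terms collapse by `Σ p_N = 1`, `Σ N p_N = ℓ² ρ`, and `ℓ → ∞`. Everything is PROVED; no
definition, no named fact.
-/

noncomputable section

namespace Literature.MathematicalPhysics.QuantumLattice

open Matrix Finset HubbardWave0 _root_.Filter Literature.Probability.LatticeModels ThermodynamicLimit
open scoped _root_.Topology ComplexOrder

/-! ### The supporting line stays below `U` at the filled band -/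

namespace ThermodynamicLimit

/-- **The supporting line of the `t–t'` energy density stays below `U` at density `2`**: if
`e(ρ) + s(x - ρ) ≤ e(x)` on `[0,2)` (`e = energyDensityTT' t t' U`, `U ≥ 0`) then `e(ρ) + s(2 - ρ) ≤ U`
(evaluate at `x_ℓ = 2 - 1/ℓ²`, where the one-hole sector of the open `ℓ × ℓ` cluster gives
`ℓ² e(x_ℓ) ≤ E_{ℓ×ℓ}(2ℓ² - 1) ≤ U(ℓ² - 1)`, and let `ℓ → ∞`). [cite: Ruelle1969, §3.3] -/
theorem supporting_line_energyDensityTT'_at_two_le (t t' : ℝ) {U : ℝ} (hU : 0 ≤ U) {ρ s : ℝ}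
    (hs : ∀ x ∈ Set.Ico (0 : ℝ) 2, energyDensityTT' t t' U ρ + s * (x - ρ) ≤ energyDensityTT' t t' U x) :
    energyDensityTT' t t' U ρ + s * (2 - ρ) ≤ U := by
  -- the one-hole sectors of the open clusters: `e(2 - 1/ℓ²) ≤ U`
  have hkey : ∀ ℓ : ℕ, 1 ≤ ℓ → energyDensityTT' t t' U ρ + s * ((2 - 1 / (ℓ : ℝ) ^ 2) - ρ) ≤ U := by
    intro ℓ hℓ
    have hℓpos : (0 : ℝ) < ℓ := by exact_mod_cast hℓ
    have hℓ2 : (0 : ℝ) < (ℓ : ℝ) ^ 2 := by positivity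
    have hℓ1 : (1 : ℝ) ≤ (ℓ : ℝ) ^ 2 := by
      have : (1 : ℝ) ≤ ℓ := by exact_mod_cast hℓ
      nlinarith
    have hN : 2 * (ℓ * ℓ) - 1 < 2 * (ℓ * ℓ) := Nat.sub_lt (by positivity) one_pos
    have hx_eq : (((2 * (ℓ * ℓ) - 1 : ℕ) : ℝ) / (ℓ : ℝ) ^ 2) = 2 - 1 / (ℓ : ℝ) ^ 2 := by
      rw [Nat.cast_sub (by nlinarith : 1 ≤ 2 * (ℓ * ℓ))]
      push_cast
      field_simp
    have hx : (2 - 1 / (ℓ : ℝ) ^ 2) ∈ Set.Ico (0 : ℝ) 2 := by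
      have h1 : 1 / (ℓ : ℝ) ^ 2 ≤ 1 := by rw [div_le_one hℓ2]; exact hℓ1
      have h2 : 0 < 1 / (ℓ : ℝ) ^ 2 := by positivity
      constructor
      · linarith
      · linarith
    have h1 := hs _ hx
    have h2 := sq_mul_energyDensityTT'_le_groundEnergy_localHamiltonian t t' hU hℓ hN
    rw [hx_eq, groundEnergy_hubbardTTPrime_localHamiltonian_halfOpenBox, hubbardOpenBoxTT'] at h2
    haveI : Nonempty (Fin ℓ ×ₗ Fin ℓ) := ⟨toLex (⟨0, hℓ⟩, ⟨0, hℓ⟩)⟩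
    have h3 := groundEnergy_hamiltonian_add_full_sub_one_le (rectBoxGraph ℓ ℓ) (rectBoxDiagGraph ℓ ℓ) t U t' 0
    rw [card_rectSites, add_zero] at h3
    push_cast at h3
    have h4 : (ℓ : ℝ) ^ 2 * energyDensityTT' t t' U (2 - 1 / (ℓ : ℝ) ^ 2) ≤ (ℓ : ℝ) ^ 2 * U := by
      nlinarith [h2, h3]
    have h5 := le_of_mul_le_mul_left h4 hℓ2
    linarith
  -- `ℓ → ∞`
  refine le_of_forall_pos_le_add fun ε hε => ?_
  obtain ⟨n, hn⟩ := exists_nat_gt (|s| / ε)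
  have h := hkey (n + 1) (Nat.le_add_left 1 n)
  push_cast at h
  have hLpos : (0 : ℝ) < (n : ℝ) + 1 := by positivity
  have hL : |s| / ε < (n : ℝ) + 1 := hn.trans (lt_add_one _)
  rw [div_lt_iff₀ hε] at hL
  have hsmall : s * (1 / ((n : ℝ) + 1) ^ 2) ≤ ε := by
    have h1 : s * (1 / ((n : ℝ) + 1) ^ 2) ≤ |s| * (1 / ((n : ℝ) + 1) ^ 2) :=
      mul_le_mul_of_nonneg_right (le_abs_self s) (by positivity)
    have h2 : |s| * (1 / ((n : ℝ) + 1) ^ 2) ≤ |s| * (1 / ((n : ℝ) + 1)) :=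
      mul_le_mul_of_nonneg_left (one_div_le_one_div_of_le hLpos
        (by have hn0 : (0 : ℝ) ≤ n := Nat.cast_nonneg n; nlinarith)) (abs_nonneg s)
    have h3 : |s| * (1 / ((n : ℝ) + 1)) ≤ ε := by
      rw [mul_one_div, div_le_iff₀ hLpos]
      linarith
    linarith
  have hsplit : s * (2 - ρ) = s * ((2 - 1 / ((n : ℝ) + 1) ^ 2) - ρ) + s * (1 / ((n : ℝ) + 1) ^ 2) := by ring
  linarith

end ThermodynamicLimit

namespace InfVolFermionState

variable {ω : InfVolFermionState 2}

/-! ### The variational lower bound -/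

/-- **No translation-invariant state has `t–t'` mean energy below the thermodynamic ground-state
energy density.** For the square-lattice Hubbard model with nearest-neighbour hopping `t`,
next-nearest-neighbour hopping `t'` and `U ≥ 0`: if `ω` is a translation-invariant infinite-volume
state of the lattice fermion system on `ℤ²` with particle density `ρ(ω) ∈ (0, 2)`, then
`energyDensityTT' t t' U ρ(ω) ≤ e^{tt'}(ω) = ω.meanEnergy (hubbardTTPrimeFermionInteraction t t' U) 1`.
(Restrict to the boxes `[0,ℓ)²`: `Re ω(H^{tt'}_{[0,ℓ)²}) ≤ ℓ² e^{tt'}(ω) + (8|t| + 16|t'|)ℓ`;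
`Re ω(H) ≥ Σ_N p_N E(N)` with the number distribution `p_N` of `ω` in the box and the sector ground
energies `E(N)` of the open-cluster Hamiltonian; `E(N) ≥ ℓ²(e(ρ) + s(N/ℓ² - ρ))` for `N < 2ℓ²` and a
supporting slope `s` of the convex `e` at `ρ`, and `E(2ℓ²) = Uℓ² ≥ ℓ²(e(ρ) + s(2 - ρ))`; summing with
`Σ p_N = 1`, `Σ N p_N = ℓ² ρ` leaves `ℓ² e(ρ) ≤ ℓ² e^{tt'}(ω) + (8|t| + 16|t'|)ℓ`, and `ℓ → ∞`.)
Ruelle (1969) §2.4, §3.3–3.4; Bratteli–Kishimoto–Robinson (1978) Thm. 2 / Araki–Moriya (2003) §7 for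
the general variational principle. [cite: Ruelle1969, §3.4] -/
theorem IsTranslationInvariant.energyDensityTT'_le_meanEnergy (hω : ω.IsTranslationInvariant)
    (t t' : ℝ) {U : ℝ} (hU : 0 ≤ U) (hρ0 : 0 < ω.density) (hρ2 : ω.density < 2) :
    energyDensityTT' t t' U ω.density ≤ ω.meanEnergy (hubbardTTPrimeFermionInteraction t t' U) 1 := by
  obtain ⟨s, hs⟩ := exists_supporting_line_energyDensityTT' t t' hU hρ0 hρ2
  have hs2 := supporting_line_energyDensityTT'_at_two_le t t' hU hs
  -- the estimate at side `ℓ ≥ 1`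
  have hbox : ∀ ℓ : ℕ, 1 ≤ ℓ → (ℓ : ℝ) ^ 2 * energyDensityTT' t t' U ω.density ≤
      (ℓ : ℝ) ^ 2 * ω.meanEnergy (hubbardTTPrimeFermionInteraction t t' U) 1 + (8 * |t| + 16 * |t'|) * ℓ := by
    intro ℓ hℓ
    have hℓpos : (0 : ℝ) < ℓ := by exact_mod_cast hℓ
    have hℓ2 : (0 : ℝ) < (ℓ : ℝ) ^ 2 := by positivity
    have hcardP : Fintype.card (PolySite (halfOpenBox 2 ℓ)) = ℓ * ℓ := by
      rw [card_polySite, card_halfOpenBox, sq]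
    obtain ⟨hHh, hHN⟩ := hubbardTTPrime_localHamiltonian_isHermitian_and_commute t t' U (halfOpenBox 2 ℓ)
    -- (4) the mean energy versus the free-boundary box Hamiltonian
    have h4 := hω.abs_sq_mul_meanEnergyTTPrime_sub_re_expect_localHamiltonian_le t' t U ℓ
    rw [abs_le] at h4
    -- (1) the sector decomposition
    have h1 := ω.sum_re_expect_numberProj_mul_groundEnergy_le (halfOpenBox 2 ℓ)
      ((hubbardTTPrimeFermionInteraction t t' U).localHamiltonian (halfOpenBox 2 ℓ)) hHh hHN
    -- (2) every sector of the box lies above the supporting line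
    have h2 : ∀ N ∈ range (Fintype.card (Orb (PolySite (halfOpenBox 2 ℓ))) + 1),
        (ℓ : ℝ) ^ 2 * (energyDensityTT' t t' U ω.density - s * ω.density) + s * N ≤
          groundEnergy ((hubbardTTPrimeFermionInteraction t t' U).localHamiltonian (halfOpenBox 2 ℓ)) N := by
      intro N hN
      rw [mem_range, card_orb, Nat.lt_succ_iff] at hN
      rcases hN.lt_or_eq with hlt | rfl
      · rw [hcardP] at hlt
        have hx : (N : ℝ) / (ℓ : ℝ) ^ 2 ∈ Set.Ico (0 : ℝ) 2 := by
          refine ⟨by positivity, ?_⟩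
          rw [div_lt_iff₀ hℓ2]
          have : (N : ℝ) < ((2 * (ℓ * ℓ) : ℕ) : ℝ) := by exact_mod_cast hlt
          push_cast at this
          linarith
        have hc : s * ((ℓ : ℝ) ^ 2 * ((N : ℝ) / (ℓ : ℝ) ^ 2)) = s * N := by rw [mul_div_cancel₀ _ hℓ2.ne']
        have hsec := sq_mul_energyDensityTT'_le_groundEnergy_localHamiltonian t t' hU hℓ hlt
        linarith [mul_le_mul_of_nonneg_left (hs _ hx) hℓ2.le]
      · rw [groundEnergy_hubbardTTPrime_localHamiltonian_halfOpenBox, hubbardOpenBoxTT', hcardP,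
          ← card_rectSites ℓ ℓ, groundEnergy_hamiltonian_add_full, card_rectSites]
        push_cast
        nlinarith [mul_le_mul_of_nonneg_left hs2 hℓ2.le]
    -- (3) the average over the number distribution `p_N = Re ω(P_N)`
    have hp1 := ω.sum_re_expect_numberProj (halfOpenBox 2 ℓ)
    have hpN : ∑ N ∈ range (Fintype.card (Orb (PolySite (halfOpenBox 2 ℓ))) + 1),
        (N : ℝ) * (ω.expect (halfOpenBox 2 ℓ) (numberProj N)).re = (ℓ : ℝ) ^ 2 * ω.density := by
      rw [ω.sum_mul_re_expect_numberProj, hω.re_expect_totalNumber, card_halfOpenBox, Nat.cast_pow]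
    have h3 : (ℓ : ℝ) ^ 2 * energyDensityTT' t t' U ω.density ≤
        ∑ N ∈ range (Fintype.card (Orb (PolySite (halfOpenBox 2 ℓ))) + 1),
          (ω.expect (halfOpenBox 2 ℓ) (numberProj N)).re *
            groundEnergy ((hubbardTTPrimeFermionInteraction t t' U).localHamiltonian (halfOpenBox 2 ℓ)) N := by
      calc (ℓ : ℝ) ^ 2 * energyDensityTT' t t' U ω.density
          = ∑ N ∈ range (Fintype.card (Orb (PolySite (halfOpenBox 2 ℓ))) + 1),
              (ω.expect (halfOpenBox 2 ℓ) (numberProj N)).re *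
                ((ℓ : ℝ) ^ 2 * (energyDensityTT' t t' U ω.density - s * ω.density) + s * N) := by
            have hexp : ∀ N : ℕ, (ω.expect (halfOpenBox 2 ℓ) (numberProj N)).re *
                ((ℓ : ℝ) ^ 2 * (energyDensityTT' t t' U ω.density - s * ω.density) + s * N) =
                ((ℓ : ℝ) ^ 2 * (energyDensityTT' t t' U ω.density - s * ω.density)) *
                    (ω.expect (halfOpenBox 2 ℓ) (numberProj N)).re +
                  s * ((N : ℝ) * (ω.expect (halfOpenBox 2 ℓ) (numberProj N)).re) := fun N => by ring
            simp_rw [hexp]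
            rw [Finset.sum_add_distrib, ← Finset.mul_sum, ← Finset.mul_sum, hp1, hpN]
            ring
        _ ≤ _ := Finset.sum_le_sum fun N hN =>
            mul_le_mul_of_nonneg_left (h2 N hN) (ω.re_expect_numberProj_nonneg _ N)
    linarith [h4.1]
  -- `ℓ → ∞`
  refine le_of_forall_pos_lt_add fun ε hε => ?_
  obtain ⟨ℓ, hℓ⟩ := exists_nat_gt ((8 * |t| + 16 * |t'|) / ε)
  have h := hbox (ℓ + 1) (Nat.le_add_left 1 ℓ)
  push_cast at h
  have hL : (8 * |t| + 16 * |t'|) / ε < (ℓ : ℝ) + 1 := hℓ.trans (lt_add_one _)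
  rw [div_lt_iff₀ hε] at hL
  have hLpos : (0 : ℝ) < (ℓ : ℝ) + 1 := by positivity
  by_contra hcon
  push Not at hcon
  nlinarith [mul_le_mul_of_nonneg_left hcon (sq_nonneg ((ℓ : ℝ) + 1)), mul_pos (sub_pos.2 hL) hLpos]

/-- The same bound stated at a prescribed density `ρ ∈ (0,2)`. [cite: Ruelle1969, §3.4] -/
theorem energyDensityTT'_le_meanEnergy_of_isTranslationInvariant (t t' : ℝ) {U : ℝ} (hU : 0 ≤ U)
    {ρ : ℝ} (hρ0 : 0 < ρ) (hρ2 : ρ < 2) (hω : ω.IsTranslationInvariant) (hρ : ω.density = ρ) :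
    energyDensityTT' t t' U ρ ≤ ω.meanEnergy (hubbardTTPrimeFermionInteraction t t' U) 1 := by
  rw [← hρ] at hρ0 hρ2 ⊢
  exact hω.energyDensityTT'_le_meanEnergy t t' hU hρ0 hρ2

/-! ### The variational principle -/

/-- **The variational principle for the ground-state energy density of the `t–t'` Hubbard model on
`ℤ²`.** For `U ≥ 0` and `0 < ρ < 2`, Ruelle's thermodynamic limit `energyDensityTT' t t' U ρ` of the
ground-state energy per site is the LEAST `t–t'` mean energy of a translation-invariant infinite-volume
state of particle density `ρ` (lower bound: `IsTranslationInvariant.energyDensityTT'_le_meanEnergy`;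
attained, by an even torus-limit state: `exists_isTorusLimitOf_squareGroundStatesTT'_meanEnergy_eq`).
Bratteli–Kishimoto–Robinson (1978) Thm. 2 / Bratteli–Robinson II Thm. 6.2.58 (ground states of
lattice systems minimise the mean energy); Ruelle (1969) §3.4. [cite: BratteliKishimotoRobinson1978, §3 Thm. 2] -/
theorem isLeast_meanEnergy_energyDensityTT' (t t' : ℝ) {U : ℝ} (hU : 0 ≤ U) {ρ : ℝ} (hρ0 : 0 < ρ)
    (hρ2 : ρ < 2) :
    IsLeast {e : ℝ | ∃ ω : InfVolFermionState 2, ω.IsTranslationInvariant ∧ ω.density = ρ ∧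
      ω.meanEnergy (hubbardTTPrimeFermionInteraction t t' U) 1 = e} (energyDensityTT' t t' U ρ) := by
  refine ⟨?_, fun e he => ?_⟩
  · obtain ⟨ψ, Ls, ω, -, -, hti, -, -, -, hdens, -, he⟩ :=
      exists_isTorusLimitOf_squareGroundStatesTT'_meanEnergy_eq t t' hU hρ0.le hρ2
    exact ⟨ω, hti, hdens, he⟩
  · obtain ⟨ω, hti, hdens, he⟩ := he
    rw [← he]
    exact energyDensityTT'_le_meanEnergy_of_isTranslationInvariant t t' hU hρ0 hρ2 hti hdens

/-- The variational principle within the EVEN translation-invariant states (the attaining torus-limit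
state is even). [cite: BratteliKishimotoRobinson1978, §3 Thm. 2] -/
theorem isLeast_meanEnergy_energyDensityTT'_even (t t' : ℝ) {U : ℝ} (hU : 0 ≤ U) {ρ : ℝ} (hρ0 : 0 < ρ)
    (hρ2 : ρ < 2) :
    IsLeast {e : ℝ | ∃ ω : InfVolFermionState 2, ω.IsTranslationInvariant ∧ ω.IsEven ∧ ω.density = ρ ∧
      ω.meanEnergy (hubbardTTPrimeFermionInteraction t t' U) 1 = e} (energyDensityTT' t t' U ρ) := by
  refine ⟨?_, fun e he => ?_⟩
  · obtain ⟨ψ, Ls, ω, -, -, hti, hev, -, -, hdens, -, he⟩ :=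
      exists_isTorusLimitOf_squareGroundStatesTT'_meanEnergy_eq t t' hU hρ0.le hρ2
    exact ⟨ω, hti, hev, hdens, he⟩
  · obtain ⟨ω, hti, -, hdens, he⟩ := he
    rw [← he]
    exact energyDensityTT'_le_meanEnergy_of_isTranslationInvariant t t' hU hρ0 hρ2 hti hdens

/-- **Lower bounds on `energyDensityTT'` are exactly the lower bounds valid for every
translation-invariant state of the right density**: for `U ≥ 0`, `0 < ρ < 2` and a real `E`,
`E ≤ energyDensityTT' t t' U ρ` iff `E ≤ e^{tt'}(ω)` for every translation-invariant `ω` on `ℤ²` of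
density `ρ` — the soundness-and-completeness statement behind certified lower bounds at the doped
`t–t'` point computed from translation-invariant-state relaxations. [cite: Ruelle1969, §3.4] -/
theorem le_energyDensityTT'_iff_forall_isTranslationInvariant (t t' : ℝ) {U : ℝ} (hU : 0 ≤ U) {ρ : ℝ}
    (hρ0 : 0 < ρ) (hρ2 : ρ < 2) (E : ℝ) :
    E ≤ energyDensityTT' t t' U ρ ↔ ∀ ω : InfVolFermionState 2, ω.IsTranslationInvariant → ω.density = ρ →
      E ≤ ω.meanEnergy (hubbardTTPrimeFermionInteraction t t' U) 1 := by
  constructor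
  · intro h ω hti hdens
    exact h.trans (energyDensityTT'_le_meanEnergy_of_isTranslationInvariant t t' hU hρ0 hρ2 hti hdens)
  · intro h
    exact le_energyDensityTT'_of_forall_isTranslationInvariant t t' hU hρ0.le hρ2 fun ω hti _ hdens => h ω hti hdens

end InfVolFermionState

end Literature.MathematicalPhysics.QuantumLattice

end
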